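import Literature.NumberTheory.EllipticCurves.SigmaSqNormLogOfRatXProofs
import Literature.NumberTheory.EllipticCurves.MinusTwistAdmissibleCycProofs
import Literature.NumberTheory.EllipticCurves.PadicSigmaSqMinusTwistUniquenessProofs
import Summits.BirchSwinnertonDyer.BirchSwinnertonDyer.Theorems.PrintCf2DisegniPairTwoDisegniGZPrelims
import HarnessLib

/-!
# Road (C) `disegni-pair-two` on crux stmt-BirchSwinnertonDyer-20368 — THE PIN AS A THEOREM: the canonical
# cyclotomic `2`-adic `H`-datum at an `H`-point with `x = X/d` equals the canonical minus-twist `ℚ`-datum at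
# `(X, Y)` (the content of the route-A aside stmt-BirchSwinnertonDyer-27316, in the frame's generality)

Cell `bsd-print-cf2` (`run/shared/lean/pub/bsd-print-cf2/`), width seat `bsd-line-cf2-p1-w8` g26.
`--supports stmt-BirchSwinnertonDyer-20368` (helper). THEOREMS ONLY (no `def`, no named fact, no `sorry`).

## What

The route-A aside `IsCanonicalCycPairingEqMinusTwist` (:= the Literature Prop
`WeierstrassCurve.isCanonicalCyc_pairing_eq_minusTwist`, ty2 g50; referee g28: «tree identity, UNPROVED,
NOT print — a prover should PROVE») is an antecedent of the v3.2 print stub `stub_prints_two` of the line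
(LEAD g21) and of the entry ticket `SplitBadTwoDisegniGZPairOfFacts` (stmt-27325, closed by -w8 g25). This
file PROVES its content in the generality the frame `stub_frame_two` supplies:

* `pairing_eq_minusTwist_pairing_of_pair` — for `V/ℚ` elliptic and `ℤ`-integral with `V ⊗ ℚ₂`
  `ℤ₂`-integral carrying a sigma-squared pair (the frame's `V = W_k`, good ordinary at `2`:
  `cm7Twist_exists_isMazurTateSigmaSqPair_two`), `d ∈ {−1, 2, −2}`, a number field `H`, a datum `DH` on
  `V(H)` with `IsCanonicalCyc` and a datum `Dc` on `V^{(d)}(ℚ)` with `IsCanonicalSqMinusTwist`: for every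
  `P = (X, Y) ∈ V^{(d)}(ℚ)` and every `H`-point `P′ = (x′, y′)` of `V` with `x′ = X/d`,
  **`⟨P′, P′⟩_{DH} = ⟨P, P⟩_{Dc}`** — factor ONE.

The all-`(V, p, d)` Literature Prop itself is NOT proved (its junk branches — `Σ_p` junk for `V` without a
sigma-squared pair, no admissible multiples off integral models — are outside this theorem); the line needs
exactly this case (`p = 2`, `d* ∈ {2, −1, −2}`, `V = W_k`).

## How (all inputs are tree theorems; trust base empty)

Polarisation (`pairing_eq_of_sq_eq_on`) of the two symmetric bilinear torsion-vanishing pairings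
`(a, b) ↦ ⟨Φ_t ι a, Φ_t ι b⟩_{DH}` (`Φ_t` = `twistPointEquivOver`, `t = d²v′/Y`, `t² = d`) and `⟨a, b⟩_{Dc}` on
`V^{(d)}(ℚ)`, which agree on the squares of minus-twist-ADMISSIBLE points `Q = (X₁, Y₁)`: there
`⟨Q,Q⟩_{Dc} = log₂ den(X₁/d) − log₂ 𝔖₂((X₁/d)⁻¹)` (receptacle), `Φ_t ι Q = (X₁/d, y₁)` is Cyc-admissible
(`satisfiesLocalConditionsCyc_of_minusTwistLocalConditions`, -w8 g26 (C)), so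
`⟨Φ_tιQ, Φ_tιQ⟩_{DH} = [H:ℚ]⁻¹(log₂ N𝔡_H(X₁/d) − sigmaSqNormLog(z))` with `N𝔡_H = den^{[H:ℚ]}` and
`sigmaSqNormLog(z) = [H:ℚ]·log₂ 𝔖₂((X₁/d)⁻¹)` (`sigmaSqNormLog_eq_of_ratCast`, -w8 g26 (D1): tower
`ℚ ⊂ ℚ(z) ⊂ H`, Vieta over `R⟦1/x⟧`, the pure-`ℚ₂` norm identity); admissible multiples exist
(`exists_isAdmissibleMinusTwist_nsmul`); finally `Φ_t ι P = ±P′` (same abscissa) and `2`-torsion when `Y = 0`.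
BSD is not proved by any of this; 20368 is not closed here.

References: B. Mazur, W. Stein, J. Tate, Doc. Math. Extra Vol. Coates (2006) §2.8 [MazurSteinTate2006];
D. Disegni, Compos. Math. 153 (2017) §4.1.1 (4.1.7)–(4.1.8) [Disegni2017]; J. H. Silverman, Math. Ann. 332
(2005) §5 Rem. 2 [Silverman2005DivPoly]; J. H. Silverman, *AEC* (2009) X.5 Cor. 5.4 [SilvermanAEC2009].
-/

set_option autoImplicit false
set_option linter.dupNamespace false

noncomputable section

open scoped Classical NumberField

open NumberField IsDedekindDomain WeierstrassCurve Literature.NumberTheory.EllipticCurves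
  Summit.BirchSwinnertonDyer.Rank1Residual.AdditivePotMult

namespace Summit.BirchSwinnertonDyer.BirchSwinnertonDyer.Theorems.PrintCf2.DisegniPairTwo

/-! ### §1 Small algebra: two points with the same abscissa; `d ∈ {−1,2,−2}` is not a rational square -/

section Algebra

/-- **Two affine points with the same `x`-coordinate are equal or opposite** (`(y₁ − y₂)(y₁ + y₂ + a₁x + a₃) = 0`).
[cite: SilvermanAEC2009, III.2.3] -/
theorem some_eq_or_eq_neg_of_x_eq {F : Type} [Field F] {W : WeierstrassCurve F} {x x₂ y₁ y₂ : F}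
    (h₁ : W.toAffine.Nonsingular x y₁) (h₂ : W.toAffine.Nonsingular x₂ y₂) (hx : x = x₂) :
    Affine.Point.some x y₁ h₁ = Affine.Point.some x₂ y₂ h₂ ∨
      Affine.Point.some x y₁ h₁ = -Affine.Point.some x₂ y₂ h₂ := by
  subst hx
  have e₁ := h₁.1
  have e₂ := h₂.1
  rw [Affine.equation_iff] at e₁ e₂
  have hmul : (y₁ - y₂) * (y₁ - W.toAffine.negY x y₂) = 0 := by
    rw [Affine.negY]; linear_combination e₁ - e₂
  rcases mul_eq_zero.mp hmul with h | h
  · left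
    have hy : y₁ = y₂ := sub_eq_zero.mp h
    subst hy
    rfl
  · right
    have hy : y₁ = W.toAffine.negY x y₂ := sub_eq_zero.mp h
    rw [Affine.Point.neg_some]
    subst hy
    rfl

/-- `−1, 2, −2` are not squares in `ℚ` (`2`: odd `2`-adic valuation). [folklore] -/
theorem sq_ne_of_eq_neg_one_or {d : ℤ} (hd : d = -1 ∨ d = 2 ∨ d = -2) (q : ℚ) : q ^ 2 ≠ (d : ℚ) := by
  intro h
  rcases hd with rfl | rfl | rfl
  · have : (0 : ℚ) ≤ q ^ 2 := sq_nonneg q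
    rw [h] at this; norm_num at this
  · haveI : Fact (Nat.Prime 2) := ⟨Nat.prime_two⟩
    have hv := congrArg (padicValRat 2) h
    rw [padicValRat.pow q, show ((2 : ℤ) : ℚ) = (2 : ℚ) by norm_num,
      show padicValRat 2 (2 : ℚ) = 1 from by simpa using padicValRat.self (p := 2) one_lt_two] at hv
    omega
  · have : (0 : ℚ) ≤ q ^ 2 := sq_nonneg q
    rw [h] at this; norm_num at this

end Algebra

/-! ### §2 The completed-square coordinate of an `H`-point above `X/d` -/

section CompletedSquare

variable (V : WeierstrassCurve ℚ) (H : Type) [Field H] [NumberField H]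

/-- **`v′² = Y²/d³`** for `P = (X, Y) ∈ V^{(d)}(ℚ)` and any `H`-point `(x′, y′)` of `V` with `x′ = X/d`, where
`v′ = y′ + (a₁x′ + a₃)/2` (`v′² = f(x′)` from the equation of `V`, `f(X/d) = Y²/d³` from the twist's).
[cite: SilvermanAEC2009, X.5 Cor. 5.4] -/
theorem completedSq_sq_eq {d X Y : ℚ} (hd0 : d ≠ 0) (hP : (V.quadraticTwist d).toAffine.Nonsingular X Y)
    {x' y' : H} (hP' : (V.baseChange H).toAffine.Nonsingular x' y') (hx : x' = algebraMap ℚ H (X / d)) :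
    (y' + ((V.baseChange H).a₁ * x' + (V.baseChange H).a₃) / 2) ^ 2 = algebraMap ℚ H (Y ^ 2 / d ^ 3) := by
  have hA1 : (V.baseChange H).a₁ = (V.a₁ : H) := by simp only [baseChange, map_a₁, eq_ratCast]
  have hA2 : (V.baseChange H).a₂ = (V.a₂ : H) := by simp only [baseChange, map_a₂, eq_ratCast]
  have hA3 : (V.baseChange H).a₃ = (V.a₃ : H) := by simp only [baseChange, map_a₃, eq_ratCast]
  have hA4 : (V.baseChange H).a₄ = (V.a₄ : H) := by simp only [baseChange, map_a₄, eq_ratCast]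
  have hA6 : (V.baseChange H).a₆ = (V.a₆ : H) := by simp only [baseChange, map_a₆, eq_ratCast]
  have eP := hP.1
  rw [Affine.equation_iff] at eP
  simp only [quadraticTwist_a₁, quadraticTwist_a₂, quadraticTwist_a₃, quadraticTwist_a₄, quadraticTwist_a₆,
    zero_mul, add_zero] at eP
  have eP' := hP'.1
  rw [Affine.equation_iff] at eP'
  rw [hA1, hA2, hA3, hA4, hA6, hx, eq_ratCast] at eP'
  -- in `ℚ`: `f(X/d) = Y²/d³`
  have hf : (X / d) ^ 3 + V.b₂ / 4 * (X / d) ^ 2 + V.b₄ / 2 * (X / d) + V.b₆ / 4 = Y ^ 2 / d ^ 3 := by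
    rw [eq_div_iff (pow_ne_zero 3 hd0), eP]
    field_simp
  push_cast at eP'
  rw [hA1, hA3, hx, eq_ratCast, eq_ratCast, ← hf]
  push_cast
  rw [WeierstrassCurve.b₂, WeierstrassCurve.b₄, WeierstrassCurve.b₆]
  push_cast
  linear_combination eP'

/-- **The `y`-coordinate above `X/d` is irrational when `Y ≠ 0` and `d` is not a rational square**: if `y′ ∈ ℚ`
then `v′ ∈ ℚ` and `(d²v′/Y)² = d`. [cite: SilvermanAEC2009, X.5 Cor. 5.4] -/
theorem y_not_mem_range_of_ne {d X Y : ℚ} (hd0 : d ≠ 0) (hnsq : ∀ q : ℚ, q ^ 2 ≠ d)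
    (hP : (V.quadraticTwist d).toAffine.Nonsingular X Y) (hY : Y ≠ 0)
    {x' y' : H} (hP' : (V.baseChange H).toAffine.Nonsingular x' y') (hx : x' = algebraMap ℚ H (X / d)) :
    y' ∉ Set.range (algebraMap ℚ H) := by
  rintro ⟨r, hr⟩
  have hsq := completedSq_sq_eq V H hd0 hP hP' hx
  have hA1 : (V.baseChange H).a₁ = algebraMap ℚ H V.a₁ := by simp only [baseChange, map_a₁]
  have hA3 : (V.baseChange H).a₃ = algebraMap ℚ H V.a₃ := by simp only [baseChange, map_a₃]
  set q : ℚ := r + (V.a₁ * (X / d) + V.a₃) / 2 with hq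
  have hv : y' + ((V.baseChange H).a₁ * x' + (V.baseChange H).a₃) / 2 = algebraMap ℚ H q := by
    rw [hq, ← hr, hA1, hA3, hx]
    simp only [map_add, map_mul, map_div₀, map_ofNat]
  rw [hv, ← map_pow] at hsq
  have hqq : q ^ 2 = Y ^ 2 / d ^ 3 := (algebraMap ℚ H).injective hsq
  apply hnsq (d ^ 2 * q / Y)
  rw [div_pow, mul_pow, hqq]
  field_simp

end CompletedSquare

/-! ### §3 The pin as a theorem -/

section Pin

variable (V : WeierstrassCurve ℚ) [V.IsElliptic] [V.IsIntegral ℤ] [(V.baseChange ℚ_[2]).IsIntegral ℤ_[2]]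
  (H : Type) [Field H] [NumberField H]

/-- **THE PIN, factor one** (the content of the aside `IsCanonicalCycPairingEqMinusTwist` /
`WeierstrassCurve.isCanonicalCyc_pairing_eq_minusTwist` in the frame's generality). For `V/ℚ` elliptic,
`ℤ`-integral, with `V ⊗ ℚ₂` `ℤ₂`-integral carrying a sigma-squared pair, `d ∈ {−1, 2, −2}`, a number field `H`,
`DH` on `V(H)` with `IsCanonicalCyc`, `Dc` on `V^{(d)}(ℚ)` with `IsCanonicalSqMinusTwist`: for every
`P = (X, Y) ∈ V^{(d)}(ℚ)` and every `H`-point `P′ = (x′, y′)` of `V` with `x′ = X/d`, `⟨P′,P′⟩_{DH} = ⟨P,P⟩_{Dc}`.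
Proof: polarisation of `(a,b) ↦ ⟨Φ_tιa, Φ_tιb⟩_{DH}` against `Dc` over the minus-twist-admissible squares
(Cyc-admissibility transfer, `sigmaSqNormLog_eq_of_ratCast`, `N𝔡_H(X₁/d) = den^{[H:ℚ]}`), admissible multiples,
`Φ_tιP = ±P′`, and `2`-torsion when `Y = 0`. [cite: MazurSteinTate2006, §2.8]
[cite: Disegni2017, §4.1.1 (4.1.7)–(4.1.8)] [cite: Silverman2005DivPoly, §5 Rem. 2] -/
theorem pairing_eq_minusTwist_pairing_of_pair
    (hpair : ∃ Sq : PowerSeries ℚ_[2], ∃ c : ℚ_[2], (V.baseChange ℚ_[2]).IsMazurTateSigmaSqPair Sq c)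
    {d : ℤ} (hd : d = -1 ∨ d = 2 ∨ d = -2) [(V.quadraticTwist (d : ℚ)).IsElliptic]
    (DH : PAdicHeightDataK V 2 H) (Dc : PAdicHeightData (V.quadraticTwist (d : ℚ)) 2)
    (hDH : DH.IsCanonicalCyc) (hDc : Dc.IsCanonicalSqMinusTwist)
    {X Y : ℚ} (hP : (V.quadraticTwist (d : ℚ)).toAffine.Nonsingular X Y) {x' y' : H}
    (hP' : (V.baseChange H).toAffine.Nonsingular x' y') (hx : x' = algebraMap ℚ H (X / (d : ℚ))) :
    DH.pairing (.some x' y' hP') (.some x' y' hP') = Dc.pairing (.some X Y hP) (.some X Y hP) := by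
  have hd0 : (d : ℚ) ≠ 0 := by rcases hd with rfl | rfl | rfl <;> norm_num
  have hnsq : ∀ q : ℚ, q ^ 2 ≠ (d : ℚ) := sq_ne_of_eq_neg_one_or hd
  have hv2 := completedSq_sq_eq V H hd0 hP hP' hx
  set v' : H := y' + ((V.baseChange H).a₁ * x' + (V.baseChange H).a₃) / 2 with hv'
  by_cases hY : Y = 0
  · -- `Y = 0`: both points are `2`-torsion
    subst hY
    have hPtors : IsOfFinAddOrder (Affine.Point.some X 0 hP) := by
      have hneg : -(Affine.Point.some X 0 hP) = Affine.Point.some X 0 hP := by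
        rw [Affine.Point.neg_some]
        congr 1
        simp [Affine.negY, quadraticTwist_a₁, quadraticTwist_a₃]
      refine isOfFinAddOrder_iff_nsmul_eq_zero.mpr ⟨2, two_pos, ?_⟩
      rw [two_nsmul]
      nth_rw 2 [← hneg]
      exact add_neg_cancel _
    have hv0 : v' = 0 := by
      have : v' ^ 2 = 0 := by rw [hv', hv2]; simp
      exact pow_eq_zero_iff two_ne_zero |>.mp this
    have hP'tors : IsOfFinAddOrder (Affine.Point.some x' y' hP') := by
      have hneg : -(Affine.Point.some x' y' hP') = Affine.Point.some x' y' hP' := by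
        rw [Affine.Point.neg_some]
        congr 1
        rw [Affine.negY]
        have : (V.baseChange H).toAffine.a₁ * x' + (V.baseChange H).toAffine.a₃ = -2 * y' := by
          have h := hv0
          rw [hv'] at h
          linear_combination 2 * h
        linear_combination -this
      refine isOfFinAddOrder_iff_nsmul_eq_zero.mpr ⟨2, two_pos, ?_⟩
      rw [two_nsmul]
      nth_rw 2 [← hneg]
      exact add_neg_cancel _
    rw [DH.map_torsion _ _ hP'tors, Dc.map_torsion _ _ hPtors]
  -- `Y ≠ 0`: the substitution `Φ_t` with `t = d² v′ / Y`, `t² = d`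
  set t : H := algebraMap ℚ H ((d : ℚ) ^ 2 / Y) * v' with htdef
  have ht2 : t ^ 2 = algebraMap ℚ H (d : ℚ) := by
    rw [htdef, mul_pow, hv2, ← map_pow, ← map_mul]
    congr 1
    field_simp
  have htQ : t ∉ Set.range (algebraMap ℚ H) := by
    rintro ⟨q, hq⟩
    apply hnsq q
    apply (algebraMap ℚ H).injective
    rw [map_pow, hq, ht2]
  set Φ := twistPointEquivOver V htQ ht2 with hΦ
  set ι : (V.quadraticTwist (d : ℚ)).toAffine.Point →+ ((V.quadraticTwist (d : ℚ)).baseChange H).toAffine.Point :=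
    Affine.Point.map (W' := V.quadraticTwist (d : ℚ)) (F := ℚ) (Algebra.ofId ℚ H) with hι
  have hιincl : ∀ Q, ι Q = QuadraticDescent.incl H (V.quadraticTwist (d : ℚ)) Q := fun Q => by
    rcases Q with _ | ⟨a, b, h⟩ <;> rfl
  set φ : (V.quadraticTwist (d : ℚ)).toAffine.Point →+ (V.baseChange H).toAffine.Point :=
    Φ.toAddMonoidHom.comp ι with hφ
  have hφapp : ∀ Q, φ Q = Φ (QuadraticDescent.incl H (V.quadraticTwist (d : ℚ)) Q) := fun Q => by
    rw [← hιincl]; rfl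
  have htinv : ∀ X₁ : ℚ, t⁻¹ ^ 2 * algebraMap ℚ H X₁ = algebraMap ℚ H (X₁ / (d : ℚ)) := fun X₁ => by
    rw [inv_pow, ht2, map_div₀]; ring
  -- finite order is reflected by `φ`
  have hφtors : ∀ Q, IsOfFinAddOrder (φ Q) → IsOfFinAddOrder Q := fun Q h => by
    have h1 := Φ.symm.toAddMonoidHom.isOfFinAddOrder h
    have h2 : Φ.symm.toAddMonoidHom (φ Q) = ι Q := by
      rw [AddEquiv.coe_toAddMonoidHom]
      exact Φ.symm_apply_apply (ι Q)
    rw [h2] at h1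
    have hinj : Function.Injective ι := Affine.Point.map_injective (W' := V.quadraticTwist (d : ℚ)) _
    exact (hinj.isOfFinAddOrder_iff).mp h1
  -- the two pairings on `V^{(d)}(ℚ)`
  set B₁ : (V.quadraticTwist (d : ℚ)).toAffine.Point →+ (V.quadraticTwist (d : ℚ)).toAffine.Point →+ ℚ_[2] :=
    (DH.pairing.comp φ).compl₂ φ with hB₁
  have hB₁app : ∀ a b, B₁ a b = DH.pairing (φ a) (φ b) := fun a b => rfl
  have key : B₁ = Dc.pairing := by
    refine pairing_eq_of_sq_eq_on B₁ Dc.pairing (fun a b => ?_) (fun a b => Dc.symm a b)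
      (fun a b ha => ?_) (fun a b ha => Dc.map_torsion a b ha)
      {Q | V.IsAdmissibleMinusTwist 2 (d : ℚ) Q} (fun Q hQ => V.exists_isAdmissibleMinusTwist_nsmul d hd Q hQ)
      (fun Q hQ => ?_)
    · rw [hB₁app, hB₁app, DH.symm]
    · rw [hB₁app]; exact DH.map_torsion _ _ (φ.isOfFinAddOrder ha)
    · -- agreement on an admissible square
      rcases Q with _ | ⟨X₁, Y₁, h₁⟩
      · exact absurd hQ (V.not_isAdmissibleMinusTwist_zero 2 (d : ℚ))
      obtain ⟨hQfin, hloc⟩ := hQ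
      obtain ⟨y₁, h₁', hφQ⟩ := x_twistPointEquivOver_incl_some' V htQ ht2 h₁
      have hx₁ : t⁻¹ ^ 2 * algebraMap ℚ H X₁ = algebraMap ℚ H (X₁ / (d : ℚ)) := htinv X₁
      have hφQ' : φ (.some X₁ Y₁ h₁) = .some (t⁻¹ ^ 2 * algebraMap ℚ H X₁) y₁ h₁' := hφQ
      -- Cyc-admissibility of `φ Q`
      have hfinφ : ¬ IsOfFinAddOrder (φ (.some X₁ Y₁ h₁)) := fun h => hQfin (hφtors _ h)
      have hCyc : V.IsAdmissibleCyc 2 H (.some (t⁻¹ ^ 2 * algebraMap ℚ H X₁) y₁ h₁') :=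
        ⟨hφQ' ▸ hfinφ, V.satisfiesLocalConditionsCyc_of_minusTwistLocalConditions hloc h₁' hx₁⟩
      -- `Y₁ ≠ 0` (else `Q` is `2`-torsion) and `y₁ ∉ ℚ`
      have hY₁ : Y₁ ≠ 0 := by
        intro hY₁
        subst hY₁
        apply hQfin
        have hneg : -(Affine.Point.some X₁ 0 h₁) = Affine.Point.some X₁ 0 h₁ := by
          rw [Affine.Point.neg_some]
          congr 1
          simp [Affine.negY, quadraticTwist_a₁, quadraticTwist_a₃]
        refine isOfFinAddOrder_iff_nsmul_eq_zero.mpr ⟨2, two_pos, ?_⟩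
        rw [two_nsmul]
        nth_rw 2 [← hneg]
        exact add_neg_cancel _
      have hy₁ : y₁ ∉ Set.range (algebraMap ℚ H) := y_not_mem_range_of_ne V H hd0 hnsq h₁ hY₁ h₁' hx₁
      have hxnorm : 1 < ‖(((X₁ / (d : ℚ) : ℚ)) : ℚ_[2])‖ := hloc.1
      -- the two values
      have hden0 : (((X₁ / (d : ℚ) : ℚ)).den : ℚ_[2]) ≠ 0 := Nat.cast_ne_zero.mpr (Rat.den_nz _)
      have hD0 : ((Module.finrank ℚ H : ℕ) : ℚ_[2]) ≠ 0 := by exact_mod_cast Module.finrank_pos.ne'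
      have heq₁ : (V.baseChange H).toAffine.Equation (((X₁ / (d : ℚ) : ℚ)) : H) y₁ := by
        rw [← eq_ratCast (algebraMap ℚ H), ← hx₁]; exact h₁'.1
      have hsig := V.sigmaSqNormLog_eq_of_ratCast (p := 2) H hpair heq₁ hy₁ hxnorm
      rw [hB₁app, hφQ', hDH.pairing_self_eq hCyc, canonicalPAdicHeightCyc_some,
        hDc.pairing_self_eq ⟨hQfin, hloc⟩, canonicalPAdicHeightSqMinusTwist_some, hx₁,
        absNorm_denominatorIdeal_algebraMap, eq_ratCast, hsig]
      push_cast
      rw [padicLog_pow 2 hden0]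
      field_simp
  -- conclusion: `⟨φP, φP⟩ = ⟨P, P⟩_{Dc}` and `φ P = ±P′`
  have hsq : DH.pairing (φ (.some X Y hP)) (φ (.some X Y hP)) = Dc.pairing (.some X Y hP) (.some X Y hP) := by
    rw [← hB₁app, key]
  obtain ⟨y₀, h₀', hφP⟩ := x_twistPointEquivOver_incl_some' V htQ ht2 hP
  have hφP' : φ (.some X Y hP) = .some (t⁻¹ ^ 2 * algebraMap ℚ H X) y₀ h₀' := by rw [hφapp]; exact hφP
  have hx₀ : t⁻¹ ^ 2 * algebraMap ℚ H X = x' := by rw [htinv, hx]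
  rw [← hsq, hφP']
  rcases some_eq_or_eq_neg_of_x_eq h₀' hP' hx₀ with h | h
  · rw [h]
  · rw [h]
    simp only [map_neg, AddMonoidHom.neg_apply, neg_neg]

end Pin

end Summit.BirchSwinnertonDyer.BirchSwinnertonDyer.Theorems.PrintCf2.DisegniPairTwo

end
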